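import Mathlib
import HarnessLib
import HarnessLib.Audit
import Summits.ResolutionOfSingularities.Statement
import Literature.AlgebraicGeometry.Resolution.ComponentGluing
import HarnessLib.Audit.Status.Attr

/-!
Route: TropicalLinks

DORMANT since 2026-08-29T19:42:18Z (census g0: costume|duplicate of —; reader census-reader-61-g0) — unstaffed, not closed; items shared with open routes are served there. `ledger route dormant <id> --off` reactivates.

# Route TropicalLinks — Tevelev's schön-open conjecture in char p by induction on dimension through
tropical links

OPEN-QUESTION HARVEST (operator A). Printed question: Tevelev, Amer. J. Math. 129 (2007) =
arXiv:math/0412329, Remark 3.3 —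
"any algebraic variety X contains a schön very affine open subset U … This conjecture is interesting
because it obviously implies the
resolution of singularities … and might be equivalent to it"; settled in characteristic 0 only, FROM
Hironaka (Luxton–Qu arXiv:0902.2009
Thm 1.4); open in every characteristic p. It suffices to show X = SchonPlus ∧ SchonResolves together
with the Descent chain shared with
route Descent (DescentAlgclosedToPerfect stmt-0550, DescentPerfectToAll stmt-0549). SchonPlus
(target, rank 0, Tevelev's conjecture made
inductive and typed over Mathlib's Laurent polynomial rings `AddMonoidAlgebra k (Fin N → ℤ)`): for
every prime p, every algebraically
closed k of characteristic p, every N and every PRIME ideal I of k[x_1^±..x_N^±] of dimension d (U =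
V(I) ⊆ 𝔾_m^N integral very affine),
there are finitely many Laurent polynomials G_1..G_m ∉ I such that the principal open U' = U[G⁻¹],
re-embedded in 𝔾_m^(N+m) by
y_j = G_j, is SCHÖN in the Gröbner form: for EVERY weight w ∈ ℤ^(N+m) the initial degeneration Spec
k[x^±,y^±]/in_w(I') is regular
(w = 0 gives U' itself; off Trop the quotient is 0). It is reached by INDUCTION ON d through the
crux InductiveStep (∀ d, SchonAt below d
⇒ SchonAt at d): the initial degeneration at a cone σ ≠ 0 of the Gröbner fan is 𝔾_m^(dim σ) × (a
LINK of dimension d − dim σ < d over the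
SAME field k), links are repaired by the induction hypothesis, and the repairing units are lifted to
U with generic dual-cone tails.
SchonResolves (crux 3): schön ⇒ resolution (Tevelev Thm 1.4 + toric resolution of fans + the
projective-coordinates trick), char-free
printed mathematics to be typed. Card realised: tropical-schoen-certificates (its THESIS; the engine
here is new — see Novelty).
Lean: `InductiveStep ∧ SchonResolves ∧ DescentAlgclosedToPerfect ∧ DescentPerfectToAll`

## Assembly
Pure logic plus ONE proved Literature lemma (sketch/SketchInline.lean = glue.lean: lean check rc 0,
0 sorries, `closes` axioms
propext · Classical.choice · Quot.sound): fix p prime; `DescentPerfectToAll p hp` reduces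
`ResolutionInChar p` to reduced X over PERFECT k;
`DescentAlgclosedToPerfect p hp` to reduced X over ALGEBRAICALLY CLOSED k; the proved
`Literature.AlgebraicGeometry.Resolution.ComponentGluing.hasResolution_of_forall_closeds`
(Cossart–Piltant Prop 4.6 Step 1) to the integral
closed subschemes Z ↪ X (again separated of finite type over k); `SchonResolves p hp` needs `∀ d,
SchonAt p d`, supplied by strong induction
`Nat.strong_induction_on` from `InductiveStep p hp`; `ResolutionOfSingularities_iff` folds the
primes. Every crux is used.

Rationale: WHY THIS LINE. Mechanism: resolution becomes a ONE-SHOT existence statement — finitely many units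
whose joint embedding has smooth initial degenerations —
and that statement, unlike resolution itself, carries an induction on dimension whose
lower-dimensional objects (the links
in_w(U)/𝔾_m^(dim σ)) are varieties over the same algebraically closed field: no imperfect residue
fields, no hypersurface of maximal
contact, no blow-up history; the terminal verification is a finite Gröbner-fan computation and the
compactification step is purely toric
(characteristic-free: Tevelev arXiv:math/0412329 Thm 1.2/1.4, Luxton–Qu arXiv:0902.2009 Thm 1.5,
KKMS fans). Imported areas: tropical
geometry (Gröbner fans, initial degenerations, tropical compactifications, Cueto–Markwig's repair of
tropicalizations by MODIFICATIONS
arXiv:1409.7430, here lifted from curves to an induction on dimension), toric geometry, and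
Teissier's overweight idea (arXiv:1401.5204) in
the form "a lift of a nilpotent initial form is overweight on U, so adjoining it as a unit enlarges
the initial ideal" (the reducedness
repair); Bertini for hyperplane sections of an embedding (Hartshorne II.8.18, valid in char p)
supplies the generic tails. What it does
that the 23 open routes do not: none of them uses tropical compactification or Gröbner
degenerations; the valuation routes (Valuative,
CyclicCovers, IndSmooth) uniformize one valuation at a time and need Zariski patching, whereas
schön-ness is one smoothness condition per
CONE of a single finite fan and coexists with defect valuations (a schön surface has plenty);
SectionAscent/VerticalModels induct on
dimension through generic sections / generic fibres over K(t), i.e. over IMPERFECT fields — here the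
field never changes.

RANKED CRUXES. #0 SchonPlus (target) — Tevelev's schön-open conjecture in characteristic p,
inductive/typed form: for every prime p and every d, SchonAt p d — every d-dimensional prime ideal I
of a Laurent polynomial ring over an algebraically closed field of char p admits finitely many G_j ∉
I such that the re-embedded principal open U[G⁻¹] ⊆ 𝔾_m^(N+m) has ALL initial degenerations regular.
(why it might fail: It is Tevelev's conjecture (AJM 2007 Rem 3.3), resolution-hard (Luxton–Qu need
Hironaka in char 0); one very affine variety over F̄_p with no schön principal-open re-embedding
refutes it (none known); d ≤ 1 holds (points; Riemann–Roch + Bertini).) [arXiv:math/0412329,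
arXiv:0902.2009, Literature.Barriers.ResolutionOfSingularities.DimensionFourFrontier]
#2 InductiveStep (crux) — THE ENGINE. For every prime p and every d: if SchonAt p d' holds for all
d' < d then SchonAt p d. Intended proof: (i) overweight lifts — a homogeneous lift of a nilpotent of
in_w(I) has larger value than its weight on every valuation over w, so adjoining it as a unit puts
the nilpotent into the new initial ideal (reducedness repair; for z^p = F it is the one-step
cleaning of p-th-power monomials); (ii) link repair — at a cone σ ≠ 0 the initial degeneration is
𝔾_m^(dim σ) × Y_σ with dim Y_σ < d over the same k, the induction hypothesis gives units schön-izing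
an open of Y_σ, and σ-homogeneous lifts with generic tails supported in exp + (σ^∨ minus σ^⊥) keep
their initial form on all of relint σ and fix the whole star of σ; (iii) Bertini (hyperplane
sections of the monomial embedding by σ^∨, char-free) makes the new boundary divisors smooth; (iv)
termination of the rounds. [difficulty: open-problem] (why it might fail: Repair rounds may not
terminate: removing singular link points spawns deeper cones whose initial ideals are again
non-radical (dominant p-th powers reappear: the tropical shadow of kangaroo/defect), and lifting
full unit lattices of links is circular between cones of equal dimension.) [arXiv:math/0412329,
arXiv:0902.2009, arXiv:1409.7430, arXiv:1401.5204,
Literature.Barriers.ResolutionOfSingularities.Hauser2003_kangarooShadeIncrease,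
Literature.Barriers.ResolutionOfSingularities.Cutkosky2014]
#3 SchonResolves (crux) — For every prime p: if SchonAt p d holds for all d then every integral
separated scheme of finite type over an algebraically closed field of char p has a resolution. Proof
plan: X ⊆ P^M projective integral (in-tree projective reduction
`Theorems…WeightedThesisProjectiveIntegralSuffices`), after a linear change U = X ∩ 𝔾_m^M is a dense
very affine open whose coordinates include x_i/x_0; SchonAt gives U' = U[G⁻¹] ⊆ 𝔾_m^(M+m) schön;
typed schön ⇒ Tevelev-schön (flat structure map with smooth fibres: the fibres ARE the initial
degenerations); any fan supported on Trop U' is tropical for schön U' (Luxton–Qu Thm 1.5), so take a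
smooth fan refining the pullback of the fan of P^M — the closure of U' in its toric variety is
smooth (Tevelev Thm 1.4) and the toric morphism to P^M restricts to a proper birational morphism
onto X. [difficulty: L] (why it might fail: Typed schön (all in_w(I') with regular quotient) must
match Tevelev's smooth structure map; 'every fan on Trop of a schön U is tropical' (Luxton–Qu 1.5)
and a smooth refinement carrying a toric MORPHISM to P^M must be re-proved in char p (printed over
alg. closed k, believed char-free).) [arXiv:math/0412329, arXiv:0902.2009, arXiv:1309.4011]
#4 DescentAlgclosedToPerfect (crux) — Shared verbatim with route Descent (stmt-0550): for a prime p,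
resolution of all reduced separated finite-type schemes over all ALGEBRAICALLY CLOSED fields of char
p implies the same over all PERFECT fields of char p. [difficulty: M] (why it might fail: Print gets
k̄ ⇒ perfect k only for Galois-EQUIVARIANT resolutions (BGMW2011 Remark; Kollar2007 Thm 3.36); a
tropical compactification is canonical in the FAN but the units G_j are chosen, so Gal-stability
needs an equivariant choice — false if some X/F_q has no Gal-stable resolution.) [arXiv:1206.3090,
Kollar2007, Literature.Barriers.ResolutionOfSingularities.InseparableBaseChange]
#5 DescentPerfectToAll (crux) — Shared verbatim with route Descent (stmt-0549): for a prime p,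
resolution of all reduced separated finite-type schemes over all PERFECT fields of char p implies
ResolutionInChar p. [difficulty: L] (why it might fail: Regular is not geometrically regular under
inseparable ground-field extension (EGA IV 6.7.4); spreading out needs k/K0 separable, impossible
when X needs more than p-rank(k) parameters (MacLane; k = F_p((t))).) [arXiv:math/0703678,
CossartPiltant2009, Literature.Barriers.ResolutionOfSingularities.InseparableBaseChange,
Literature.Barriers.ResolutionOfSingularities.RegularNotGeometricallyRegular]
#9 SchonLowDim (support) — Calibration rung: SchonAt p d for d ≤ 2. d = 0: a point is schön (all
initial ideals ⊤ or the point). d = 1: remove the singular points, then Riemann–Roch units with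
prescribed pole/zero orders make every puncture's valuation vector primitive and punctures in one
direction distinct; Bertini (Hartshorne II.8.18, char-free) gives generic units with simple zeros. d
= 2: port Luxton–Qu's char-0 proof (their Prop 3.1 + proof of Thm 1.4) using Cossart–Jannsen–Saito
EMBEDDED resolution of surfaces (char p, known) in place of Hironaka — a new small theorem ('every
surface over F̄_p has a schön very affine open') and the first test of the typing. [difficulty: M]
[arXiv:0902.2009, arXiv:math/0412329, CossartJannsenSaito2009]

TWO-LAYER PLAN. Foreseen glued splits (nothing filed now). InductiveStep ⇐ OverweightLift →
LinkRepair → RoundsTerminate → InductiveStep: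
OverweightLift = some unit-extension of U has every initial ideal radical with reduced
equidimensional links (one global cleaning for
hypersurfaces z^p = F); LinkRepair = given that and SchonAt below d, one round of σ-homogeneous
lifts of the links' intrinsic unit lattices
with generic (σ^∨ minus σ^⊥)-tails makes U schön along the star of every current bad cone and
creates bad cones only over old bad cones;
RoundsTerminate = the bad-cone configuration decreases in a well-order. SchonResolves ⇐
SchonCriterion (typed ⇒ Tevelev) → FanRefinement
(Luxton–Qu 1.5 + smooth refinement with a toric morphism to P^M) → ProjectiveTrick (in-tree
projective reduction).

KILL CRITERIA. A very affine variety over F̄_p (any d ≥ 2) with NO schön principal-open re-embedding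
refutes SchonPlus and InductiveStep outright →
`close --reason refuted:InductiveStep` (and Tevelev's conjecture dies in char p — a publishable
negative). SchonLowDim false at d = 2 → same.
If the repair rounds provably loop on some z^p = F surface while SchonAt p 2 holds by porting
Luxton–Qu, the ENGINE is dead but the thesis
stands: pivot InductiveStep to a different inductive cut (e.g. induction on the number of bad cones)
or retire honestly as 'thesis known,
no engine'. The summit proved by any other route moots the route (SchonPlus keeps independent
interest; close superseded).

NOT DECOMPOSED YET. The cone/star/link vocabulary (the Gröbner fan of I as a finite complete fan,
the torus-factor splitting in_w(U) ≅ 𝔾_m^(dim σ) × Y_σ, the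
intrinsic torus O^*(U)/k^*) is deliberately NOT typed at open — the items speak only of initial
ideals for all integer weights, which
needs nothing beyond Mathlib; the layer-2 children above need these notions and wait for the
definition requests. No constants or regime
splits at open; p = 2 is not special here.

CHEAPEST FALSIFIER. Computation (not run this session: no Gröbner-fan engine on the hub; it is the
first layer-2 task, a ONE-job kit spec): over F_p, p ∈ {2,3},
take U = {z^p = F(x,y)} ∩ 𝔾_m^3 for the barrier specimens one dimension down (char 2: z² = x³y + xy³
+ x⁵, Narasimhan-type; char 3:
z³ = x²y + xy⁴ + y⁷) and random F of degree ≤ 8; run: clean p-th-power monomials; Gröbner fan of I'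
(Singular/gfanlib in char p); list cones
with non-regular in_w; repair each link CURVE by Riemann–Roch units, lift σ-homogeneously with
random dual-cone tails; iterate ≤ 6 rounds,
≤ 20 units. Outcome 'schön reached' on all = first evidence for InductiveStep at d = 2 beyond
LQ-porting; a specimen where bad cones
proliferate round after round = the engine's death certificate (attach as evidence). Lookups run: d
= 0, 1 of SchonAt by hand (fine);
Luxton–Qu Lemma 2.13 (schön in a sub-torus ⇒ schön in the intrinsic torus) read on p.6 — it is why
full unit lattices of links are lifted.

NUMBERS. d ≤ 1: SchonAt holds (elementary). d = 2: expected from CJS embedded surface resolution via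
Luxton–Qu's construction (support SchonLowDim).
d = 3: OPEN and already new (no schön model of a general threefold in char p is in print although
resolution is, CossartPiltant2019).
Tevelev's conjecture in char 0: theorem (arXiv:0902.2009 Thm 1.4, via Hironaka).

DEFINITION REQUESTS. (filed after open, `--for` the InductiveStep item) InitialIdeal — `in_w(I)` for
an ideal of `AddMonoidAlgebra k (Fin N → ℤ)` and integer
weight, with the Gröbner-fan finiteness fact (finitely many distinct in_w) as a cite fact [topic
Literature/AlgebraicGeometry/TropicalManifolds
or a new Literature/AlgebraicGeometry/Tropical]; IsSchonIdeal — all initial degenerations regular,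
plus the named facts Tevelev2007 Thm 1.4
(schön ⇒ every tropical compactification has smooth structure map; closure in a smooth toric variety
is smooth with combinatorial normal
crossings boundary) and LuxtonQu2011 Thm 1.5 / Lemma 2.13 / Prop 3.1; TropicalLink — the splitting
in_w(U) ≅ torus × link. Once landed,
a tenure pass restates the four own items through them (same meaning, shorter text).

Novelty: Searches (2026-08-16): lit frontier ResolutionOfSingularities --since 2021 (60 rows; read
arXiv:2602.06553, 2605.22046, 2303.18085,
2510.26648, 2604.23591, 2004.11004); lit read of arXiv:2502.01239 (Teissier singularities, 2025),
arXiv:2405.05735 (Posva 2024),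
arXiv:0706.2700 via card (Yasuda Q1.4), arXiv:1305.7502, arXiv:1009.0252; lit search --source arxiv:
"tropical modification repair
tropicalization" (1 hit: arXiv:1409.7430), "tropical compactification positive characteristic
resolution singularities" (2: arXiv:2605.04252,
2408.06270), "Luxton Qu tropical compactification" (1), "schon very affine tropical
compactification" (0); lit search --source zbmath:
"schön compactification" (10: Tevelev, Luxton–Qu, Ulirsch arXiv:1309.4011, Schock arXiv:2112.02062,
Corey arXiv:1708.03060 …),
"schoen very affine open" (2), "faithful tropicalization higher dimension modification" (0); local
`lit search` daemon down all session
(ConnectionResetError; noted), openalex/s2 rate-limited; ledger idea list (184 cards read by title;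
tropical-schoen-certificates,
schoen-reembedding, kunz-frobenius-flattening-tower, ifp-third-arrow, alpha-p-to-mu-p read in full);
all 23 route files read; Cruxes/
WeightedThesis PICKED.md read (Kunz tower is an active LINE — candidate dropped for that reason).
Nearest prior art found: arXiv:math/0412329 Rem 3.3 (Tevelev: the thesis as a printed conjecture,
'implies resolution'); arXiv:0902.2009
(Luxton–Qu: char 0 FROM Hironaka; Lemma 2.13 intrinsic torus; Prop 3.  [refs: 2602.06553, 2502.01239, 2405.05735, 0706.2700, 1305.7502, 1009.0252, 1409.7430, 2605.04252, 1309.4011, 2112.02062, 1708.03060, math/0412329, 0902.2009, 1401.5204]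

Barriers (technique_class: tropical-compactification, link-induction): - technique_class: tropical-compactification, link-induction
- Literature.Barriers.ResolutionOfSingularities.Hauser2003_kangarooShadeIncrease: evaded by
construction — no blow-up, no residual order, no maximisation over coordinate choices; the analogous
risk (repair rounds do not terminate because deeper cones turn non-radical again) is NOT assumed
away: it is the rank-2 crux's stated failure mode. The bet: schön-ness asks one smooth initial
degeneration per CONE of a finite fan, not the resolution of every valuation's graded algebra (schön
surfaces coexist with defect valuations of their function fields).
- Literature.Barriers.ResolutionOfSingularities.hauserPerlega_mohProofBoundFails: same evasion
(residual orders are never used); same honest residue (termination of rounds).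
- Literature.Barriers.ResolutionOfSingularities.Narasimhan1983_noSmoothHypersurfaceThroughTopLocus:
not applicable — no hypersurface of maximal contact and no centre is chosen; the lower-dimensional
objects are initial degenerations, canonical given the embedding.
- Literature.Barriers.ResolutionOfSingularities.hironakaQuadric_directrixZero_and_nearPoint: not
applicable — no directrix; residue fields never leave the algebraically closed k (links are
k-varieties), which is the point of the induction.
- Literature.Barriers.ResolutionOfSingularities.chevalley_barrier: applies to the toric endgame
ALONE (toric blow-ups/Kummer reparametrisations cannot see Artin–Schreier roots); evaded because the
engine adj

History (route lifecycle, newest last):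
- 2026-08-25T07:59:12Z · DORMANT — reconciler: no traction for 7.5 d (last activity item-evidence-added at 2026-08-17T19:05:11Z); parked, not closed — `ledger route dormant route-ResolutionOfSing (operator:999:3125842)
- 2026-08-26T17:02:59Z · REACTIVATED — reconciler: reactivated — activity statement-claimed at 2026-08-26T16:25:04Z after parking at 2026-08-25T07:59:12Z (operator:999:3670831)
- 2026-08-29T19:42:18Z · DORMANT — census g0: costume|duplicate of —; reader census-reader-61-g0 (operator:999:1720911)

sub-problem: ResolutionOfSingularities · status: dormant · opened planner-plan-novel-ResolutionOfSingularities-Re-dc19aa3a-a-v2-g13-0 2026-08-16T22:55:23Z · rev 2 · ledger route-ResolutionOfSingularities-TropicalLinks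
GENERATED by the gate from the ledger (D-0016/17). Provers cite these decls: `theorem foo : Summit.ResolutionOfSingularities.ResolutionOfSingularities.Theses.TropicalLinks.<Decl> := …` in Summits/ResolutionOfSingularities/ResolutionOfSingularities/Theorems/<Name>.lean.
-/

namespace Summit.ResolutionOfSingularities.ResolutionOfSingularities.Theses.TropicalLinks

open scoped BigOperators Topology Manifold Classical MeasureTheory ProbabilityTheory Matrix InnerProductSpace ComplexConjugate ContinuousMap
open Filter Set Function TopologicalSpace MeasureTheory

attribute [summit_statement] _root_.ResolutionOfSingularities

/-- item stmt-ResolutionOfSingularities-17232 · target · rank 0 · open · by planner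
why it might fail: It is Tevelev's conjecture (AJM 2007 Rem 3.3), resolution-hard (Luxton–Qu need Hironaka in char 0); one very affine variety over F̄_p with no schön principal-open re-embedding refutes it (none known); d ≤ 1 holds (points; Riemann–Roch + Bertini).
sources: arXiv:math/0412329, arXiv:0902.2009, Literature.Barriers.ResolutionOfSingularities.DimensionFourFrontier
[target] Tevelev's schön-open conjecture in characteristic p, inductive/typed form: for every prime
p and every d, SchonAt p d — every d-dimensional prime ideal I of a Laurent polynomial ring over an
algebraically closed field of char p admits finitely many G_j ∉ I such that the re-embedded
principal open U[G⁻¹] ⊆ 𝔾_m^(N+m) has ALL initial degenerations regular. -/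
@[route_item "route-ResolutionOfSingularities-TropicalLinks"]
def SchonPlus : Prop :=
  ∀ p : ℕ, p.Prime → ∀ d : ℕ, (fun (p d : ℕ) => ∀ (k : Type) [Field k] [CharP k p] [IsAlgClosed k] (N : ℕ) (I : Ideal (AddMonoidAlgebra k (Fin N → ℤ))), I.IsPrime → ringKrullDim (AddMonoidAlgebra k (Fin N → ℤ) ⧸ I) = (d : WithBot ℕ∞) → ∃ (m : ℕ) (G : Fin m → AddMonoidAlgebra k (Fin N → ℤ)), (∀ j, G j ∉ I) ∧ ∀ (w : Fin (N + m) → ℤ) (P : Ideal (AddMonoidAlgebra k (Fin (N + m) → ℤ) ⧸ Ideal.span ((fun f : AddMonoidAlgebra k (Fin (N + m) → ℤ) => AddMonoidAlgebra.ofCoeff (f.coeff.filter fun v => ∀ u ∈ f.coeff.support, ∑ i, w i * v i ≤ ∑ i, w i * u i)) '' (↑(Ideal.span ((fun f : AddMonoidAlgebra k (Fin N → ℤ) => (AddMonoidAlgebra.ofCoeff (f.coeff.mapDomain fun v => Fin.append v (0 : Fin m → ℤ)) : AddMonoidAlgebra k (Fin (N + m) → ℤ))) '' (↑I : Set (AddMonoidAlgebra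 k (Fin N → ℤ))) ∪ Set.range (fun j : Fin m => AddMonoidAlgebra.single (Fin.append (0 : Fin N → ℤ) (Pi.single j (1 : ℤ))) (1 : k) - AddMonoidAlgebra.ofCoeff ((G j).coeff.mapDomain fun v => Fin.append v (0 : Fin m → ℤ))))) : Set (AddMonoidAlgebra k (Fin (N + m) → ℤ)))))) [P.IsPrime], IsRegularLocalRing (Localization.AtPrime P)) p d

/-- item stmt-ResolutionOfSingularities-17233 · crux · rank 2 · open · by planner
why it might fail: Repair rounds may not terminate: removing singular link points spawns deeper cones whose initial ideals are again non-radical (dominant p-th powers reappear: the tropical shadow of kangaroo/defect), and lifting full unit lattices of links is circular between cones of equal dimension.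
sources: arXiv:math/0412329, arXiv:0902.2009, arXiv:1409.7430, arXiv:1401.5204, Literature.Barriers.ResolutionOfSingularities.Hauser2003_kangarooShadeIncrease, Literature.Barriers.ResolutionOfSingularities.Cutkosky2014
[crux] THE ENGINE. For every prime p and every d: if SchonAt p d' holds for all d' < d then SchonAt
p d. Intended proof: (i) overweight lifts — a homogeneous lift of a nilpotent of in_w(I) has larger
value than its weight on every valuation over w, so adjoining it as a unit puts the nilpotent into
the new initial ideal (reducedness repair; for z^p = F it is the one-step cleaning of p-th-power
monomials); (ii) link repair — at a cone σ ≠ 0 the initial degeneration is 𝔾_m^(dim σ) × Y_σ with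
dim Y_σ < d over the same k, the induction hypothesis gives units schön-izing an open of Y_σ, and
σ-homogeneous lifts with generic tails supported in exp + (σ^∨ minus σ^⊥) keep their initial form on
all of relint σ and fix the whole star of σ; (iii) Bertini (hyperplane sections of the monomial
embedding by σ^∨, char-free) makes the new boundary divisors smooth; (iv) termination of the rounds.
[difficulty: open-problem] -/
@[route_item "route-ResolutionOfSingularities-TropicalLinks", crux]
def InductiveStep : Prop :=
  ∀ p : ℕ, p.Prime → ∀ d : ℕ, (∀ d' < d, (fun (p d : ℕ) => ∀ (k : Type) [Field k] [CharP k p] [IsAlgClosed k] (N : ℕ) (I : Ideal (AddMonoidAlgebra k (Fin N → ℤ))), I.IsPrime → ringKrullDim (AddMonoidAlgebra k (Fin N → ℤ) ⧸ I) = (d : WithBot ℕ∞) → ∃ (m : ℕ) (G : Fin m → AddMonoidAlgebra k (Fin N → ℤ)), (∀ j, G j ∉ I) ∧ ∀ (w : Fin (N + m) → ℤ) (P : Ideal (AddMonoidAlgebra k (Fin (N + m) → ℤ) ⧸ Ideal.span ((fun f : AddMonoidAlgebra k (Fin (N + m) → ℤ) => AddMonoidAlgebra.ofCoeff (f.coeff.filter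 fun v => ∀ u ∈ f.coeff.support, ∑ i, w i * v i ≤ ∑ i, w i * u i)) '' (↑(Ideal.span ((fun f : AddMonoidAlgebra k (Fin N → ℤ) => (AddMonoidAlgebra.ofCoeff (f.coeff.mapDomain fun v => Fin.append v (0 : Fin m → ℤ)) : AddMonoidAlgebra k (Fin (N + m) → ℤ))) '' (↑I : Set (AddMonoidAlgebra k (Fin N → ℤ))) ∪ Set.range (fun j : Fin m => AddMonoidAlgebra.single (Fin.append (0 : Fin N → ℤ) (Pi.single j (1 : ℤ))) (1 : k) - AddMonoidAlgebra.ofCoeff ((G j).coeff.mapDomain fun v => Fin.append v (0 : Fin m → ℤ))))) : Set (AddMonoidAlgebra k (Fin (N + m) → ℤ)))))) [P.IsPrime], IsRegularLocalRing (Localization.AtPrime P)) p d') → (fun (p d : ℕ) => ∀ (k : Type) [Field k] [CharP k p] [IsAlgClosed k] (N : ℕ) (I : Ideal (AddMonoidAlgebra k (Fin N → ℤ))), I.IsPrime → ringKrullDim (AddMonoidAlgebra k (Fin N → ℤ) ⧸ I) = (d : WithBot ℕ∞) → ∃ (m : ℕ) (G : Fin m → AddMonoidAlgebra k (Fin N →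 ℤ)), (∀ j, G j ∉ I) ∧ ∀ (w : Fin (N + m) → ℤ) (P : Ideal (AddMonoidAlgebra k (Fin (N + m) → ℤ) ⧸ Ideal.span ((fun f : AddMonoidAlgebra k (Fin (N + m) → ℤ) => AddMonoidAlgebra.ofCoeff (f.coeff.filter fun v => ∀ u ∈ f.coeff.support, ∑ i, w i * v i ≤ ∑ i, w i * u i)) '' (↑(Ideal.span ((fun f : AddMonoidAlgebra k (Fin N → ℤ) => (AddMonoidAlgebra.ofCoeff (f.coeff.mapDomain fun v => Fin.append v (0 : Fin m → ℤ)) : AddMonoidAlgebra k (Fin (N + m) → ℤ))) '' (↑I : Set (AddMonoidAlgebra k (Fin N → ℤ))) ∪ Set.range (fun j : Fin m => AddMonoidAlgebra.single (Fin.append (0 : Fin N → ℤ) (Pi.single j (1 : ℤ))) (1 : k) - AddMonoidAlgebra.ofCoeff ((G j).coeff.mapDomain fun v => Fin.append v (0 : Fin m → ℤ))))) : Set (AddMonoidAlgebra k (Fin (N + m) → ℤ)))))) [P.IsPrime], IsRegularLocalRing (Localization.AtPrime P)) p d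

/-- item stmt-ResolutionOfSingularities-17234 · crux · rank 3 · open · by planner
why it might fail: Typed schön (all in_w(I') with regular quotient) must match Tevelev's smooth structure map; 'every fan on Trop of a schön U is tropical' (Luxton–Qu 1.5) and a smooth refinement carrying a toric MORPHISM to P^M must be re-proved in char p (printed over alg. closed k, believed char-free).
sources: arXiv:math/0412329, arXiv:0902.2009, arXiv:1309.4011
[crux] For every prime p: if SchonAt p d holds for all d then every integral separated scheme of
finite type over an algebraically closed field of char p has a resolution. Proof plan: X ⊆ P^M
projective integral (in-tree projective reduction
`Theorems…WeightedThesisProjectiveIntegralSuffices`), after a linear change U = X ∩ 𝔾_m^M is a dense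
very affine open whose coordinates include x_i/x_0; SchonAt gives U' = U[G⁻¹] ⊆ 𝔾_m^(M+m) schön;
typed schön ⇒ Tevelev-schön (flat structure map with smooth fibres: the fibres ARE the initial
degenerations); any fan supported on Trop U' is tropical for schön U' (Luxton–Qu Thm 1.5), so take a
smooth fan refining the pullback of the fan of P^M — the closure of U' in its toric variety is
smooth (Tevelev Thm 1.4) and the toric morphism to P^M restricts to a proper birational morphism
onto X. [difficulty: L] -/
@[route_item "route-ResolutionOfSingularities-TropicalLinks", crux]
def SchonResolves : Prop :=
  ∀ p : ℕ, p.Prime → (∀ d : ℕ, (fun (p d : ℕ) => ∀ (k : Type) [Field k] [CharP k p] [IsAlgClosed k] (N : ℕ) (I : Ideal (AddMonoidAlgebra k (Fin N → ℤ))), I.IsPrime → ringKrullDim (AddMonoidAlgebra k (Fin N → ℤ) ⧸ I) = (d : WithBot ℕ∞) → ∃ (m : ℕ) (G : Fin m → AddMonoidAlgebra k (Fin N → ℤ)), (∀ j, G j ∉ I) ∧ ∀ (w : Fin (N + m) → ℤ) (P : Ideal (AddMonoidAlgebra k (Fin (N + m) → ℤ) ⧸ Ideal.span ((fun f : AddMonoidAlgebra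 k (Fin (N + m) → ℤ) => AddMonoidAlgebra.ofCoeff (f.coeff.filter fun v => ∀ u ∈ f.coeff.support, ∑ i, w i * v i ≤ ∑ i, w i * u i)) '' (↑(Ideal.span ((fun f : AddMonoidAlgebra k (Fin N → ℤ) => (AddMonoidAlgebra.ofCoeff (f.coeff.mapDomain fun v => Fin.append v (0 : Fin m → ℤ)) : AddMonoidAlgebra k (Fin (N + m) → ℤ))) '' (↑I : Set (AddMonoidAlgebra k (Fin N → ℤ))) ∪ Set.range (fun j : Fin m => AddMonoidAlgebra.single (Fin.append (0 : Fin N → ℤ) (Pi.single j (1 : ℤ))) (1 : k) - AddMonoidAlgebra.ofCoeff ((G j).coeff.mapDomain fun v => Fin.append v (0 : Fin m → ℤ))))) : Set (AddMonoidAlgebra k (Fin (N + m) → ℤ)))))) [P.IsPrime], IsRegularLocalRing (Localization.AtPrime P)) p d) → ∀ (k : Type) [Field k] [CharP k p] [IsAlgClosed k] (X : AlgebraicGeometry.Scheme.{0}) (f : X ⟶ AlgebraicGeometry.Spec (.of k)), AlgebraicGeometry.IsSeparated f → AlgebraicGeometry.LocallyOfFiniteType f → AlgebraicGeometry.QuasiCompact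 f → AlgebraicGeometry.IsIntegral X → Literature.AlgebraicGeometry.Resolution.Scheme.HasResolution X

/-- item stmt-ResolutionOfSingularities-0550 · crux · rank 4 · open · by planner
why it might fail: Print gets k̄ ⇒ perfect k only for Galois-EQUIVARIANT resolutions (BGMW2011 Remark; Kollar2007 Thm 3.36); a tropical compactification is canonical in the FAN but the units G_j are chosen, so Gal-stability needs an equivariant choice — false if some X/F_q has no Gal-stable resolution.
sources: arXiv:1206.3090, Kollar2007, Literature.Barriers.ResolutionOfSingularities.InseparableBaseChange
AlgClosedToPerfect: for a prime p, resolution of all reduced separated finite-type schemes over all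
ALGEBRAICALLY CLOSED fields of char p implies the same over all PERFECT fields of char p. Needs
Galois descent of some resolution (a Gal-invariant one), i.e. a canonicity input, or a trick
avoiding it. -/
@[route_item "route-ResolutionOfSingularities-TropicalLinks", crux]
def DescentAlgclosedToPerfect : Prop :=
  ∀ p : ℕ, p.Prime → (∀ (k : Type) [Field k] [CharP k p] [IsAlgClosed k] (X : AlgebraicGeometry.Scheme.{0}) (f : X ⟶ AlgebraicGeometry.Spec (.of k)), AlgebraicGeometry.IsSeparated f → AlgebraicGeometry.LocallyOfFiniteType f → AlgebraicGeometry.QuasiCompact f → AlgebraicGeometry.IsReduced X → Literature.AlgebraicGeometry.Resolution.Scheme.HasResolution X) → ∀ (k : Type) [Field k] [CharP k p] [PerfectField k] (X : AlgebraicGeometry.Scheme.{0}) (f : X ⟶ AlgebraicGeometry.Spec (.of k)), AlgebraicGeometry.IsSeparated f → AlgebraicGeometry.LocallyOfFiniteType f → AlgebraicGeometry.QuasiCompact f → AlgebraicGeometry.IsReduced X → Literature.AlgebraicGeometry.Resolution.Scheme.HasResolution X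

/-- item stmt-ResolutionOfSingularities-0549 · crux · rank 5 · open · by planner
why it might fail: Regular is not geometrically regular under inseparable ground-field extension (EGA IV 6.7.4); spreading out needs k/K0 separable, impossible when X needs more than p-rank(k) parameters (MacLane; k = F_p((t))).
sources: arXiv:math/0703678, CossartPiltant2009, Literature.Barriers.ResolutionOfSingularities.InseparableBaseChange, Literature.Barriers.ResolutionOfSingularities.RegularNotGeometricallyRegular
PerfectToAll: for a prime p, resolution of all reduced separated finite-type schemes over all
PERFECT fields of char p implies ResolutionInChar p (all fields of char p). Expected inputs:
Neron-Popescu (Stacks 07GC), spreading out, openness of regular locus on excellent schemes;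
regularity is not stable under inseparable ground field extension, which is the difficulty. -/
@[route_item "route-ResolutionOfSingularities-TropicalLinks", crux]
def DescentPerfectToAll : Prop :=
  ∀ p : ℕ, p.Prime → (∀ (k : Type) [Field k] [CharP k p] [PerfectField k] (X : AlgebraicGeometry.Scheme.{0}) (f : X ⟶ AlgebraicGeometry.Spec (.of k)), AlgebraicGeometry.IsSeparated f → AlgebraicGeometry.LocallyOfFiniteType f → AlgebraicGeometry.QuasiCompact f → AlgebraicGeometry.IsReduced X → Literature.AlgebraicGeometry.Resolution.Scheme.HasResolution X) → Literature.AlgebraicGeometry.Resolution.ResolutionInChar.{0} p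

/-- item stmt-ResolutionOfSingularities-17235 · support · rank 9 · open · by planner
sources: arXiv:0902.2009, arXiv:math/0412329, CossartJannsenSaito2009
[support] Calibration rung: SchonAt p d for d ≤ 2. d = 0: a point is schön (all initial ideals ⊤ or
the point). d = 1: remove the singular points, then Riemann–Roch units with prescribed pole/zero
orders make every puncture's valuation vector primitive and punctures in one direction distinct;
Bertini (Hartshorne II.8.18, char-free) gives generic units with simple zeros. d = 2: port
Luxton–Qu's char-0 proof (their Prop 3.1 + proof of Thm 1.4) using Cossart–Jannsen–Saito EMBEDDED
resolution of surfaces (char p, known) in place of Hironaka — a new small theorem ('every surface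
over F̄_p has a schön very affine open') and the first test of the typing. [difficulty: M] -/
@[route_item "route-ResolutionOfSingularities-TropicalLinks"]
def SchonLowDim : Prop :=
  ∀ p : ℕ, p.Prime → ∀ d ≤ 2, (fun (p d : ℕ) => ∀ (k : Type) [Field k] [CharP k p] [IsAlgClosed k] (N : ℕ) (I : Ideal (AddMonoidAlgebra k (Fin N → ℤ))), I.IsPrime → ringKrullDim (AddMonoidAlgebra k (Fin N → ℤ) ⧸ I) = (d : WithBot ℕ∞) → ∃ (m : ℕ) (G : Fin m → AddMonoidAlgebra k (Fin N → ℤ)), (∀ j, G j ∉ I) ∧ ∀ (w : Fin (N + m) → ℤ) (P : Ideal (AddMonoidAlgebra k (Fin (N + m) → ℤ) ⧸ Ideal.span ((fun f : AddMonoidAlgebra k (Fin (N + m) → ℤ) => AddMonoidAlgebra.ofCoeff (f.coeff.filter fun v => ∀ u ∈ f.coeff.support, ∑ i, w i * v i ≤ ∑ i, w i * u i)) '' (↑(Ideal.span ((fun f : AddMonoidAlgebra k (Fin N → ℤ) => (AddMonoidAlgebra.ofCoeff (f.coeff.mapDomain fun v => Fin.append v (0 : Fin m → ℤ)) : AddMonoidAlgebra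 k (Fin (N + m) → ℤ))) '' (↑I : Set (AddMonoidAlgebra k (Fin N → ℤ))) ∪ Set.range (fun j : Fin m => AddMonoidAlgebra.single (Fin.append (0 : Fin N → ℤ) (Pi.single j (1 : ℤ))) (1 : k) - AddMonoidAlgebra.ofCoeff ((G j).coeff.mapDomain fun v => Fin.append v (0 : Fin m → ℤ))))) : Set (AddMonoidAlgebra k (Fin (N + m) → ℤ)))))) [P.IsPrime], IsRegularLocalRing (Localization.AtPrime P)) p d

/-- item stmt-ResolutionOfSingularities-17236 · assembly · rank 1 · open · by planner
sources: arXiv:math/0412329, arXiv:1412.0868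
[assembly] InductiveStep → SchonResolves → DescentAlgclosedToPerfect → DescentPerfectToAll → the
summit statement. -/
@[route_item "route-ResolutionOfSingularities-TropicalLinks"]
def Assembly : Prop :=
  InductiveStep → SchonResolves → DescentAlgclosedToPerfect → DescentPerfectToAll → _root_.ResolutionOfSingularities

/-! D-0027 §2.1 — DECIDING THEOREM (planner-authored via `route open/edit --closes-file`; by planner-plan-novel-ResolutionOfSingularities-Re-dc19aa3a-a-v 2026-08-16T22:55:23Z):
its hypotheses are this route's items and its conclusion the sub-problem Statement (glue_lint), and it elaborates with this file. -/

/-- DECIDING THEOREM of route TropicalLinks (D-0027 §2.1): strong induction on the dimension `d`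
through `InductiveStep` yields `SchonAt p d` for every `d`; `SchonResolves` turns that into resolution
of INTEGRAL separated finite-type schemes over ALGEBRAICALLY CLOSED fields of characteristic `p`; the
PROVED Literature lemma `ComponentGluing.hasResolution_of_forall_closeds` (Cossart–Piltant Prop 4.6
Step 1) passes from integral closed subschemes to reduced `X`; `DescentAlgclosedToPerfect` and
`DescentPerfectToAll` (shared with route Descent) give `ResolutionInChar p`; `ResolutionOfSingularities_iff`
folds the primes. Every crux is used; pure logic otherwise. -/
@[closes "route-ResolutionOfSingularities-TropicalLinks"] theorem closes (hStep : InductiveStep) (hRes : SchonResolves) (hAlg : DescentAlgclosedToPerfect)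
    (hPerf : DescentPerfectToAll) : _root_.ResolutionOfSingularities :=
  _root_.ResolutionOfSingularities_iff.mpr fun p hp =>
    hPerf p hp (hAlg p hp fun k _ _ _ X f _ _ _ _ =>
      Literature.AlgebraicGeometry.Resolution.ComponentGluing.hasResolution_of_forall_closeds X f fun Z hZ =>
        hRes p hp (fun d => Nat.strong_induction_on d fun d ih => hStep p hp d ih) k
          (AlgebraicGeometry.Scheme.IdealSheafData.subscheme (AlgebraicGeometry.Scheme.IdealSheafData.vanishingIdeal Z))
          (CategoryTheory.CategoryStruct.comp (AlgebraicGeometry.Scheme.IdealSheafData.vanishingIdeal Z).subschemeι f)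
          inferInstance inferInstance inferInstance hZ)

end Summit.ResolutionOfSingularities.ResolutionOfSingularities.Theses.TropicalLinks
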